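import Mathlib
import HarnessLib
import Summits.HubbardSuperconductivity.HubbardSuperconductivity.Theorems.KLProgrammeKLRegimeEngineFlowEnvelopeChoice
import Summits.HubbardSuperconductivity.HubbardSuperconductivity.Theorems.KLProgrammeKLRegimeEngineV8DefsL4
import Summits.HubbardSuperconductivity.HubbardSuperconductivity.Theorems.KLProgrammeKLRegimeSplitFrameDegreeGuard

/-!
# K3 gen-8-FLOW (stmt 20437 `KLRegimeEngineV17F2`, stub (C), located risk «(C)-B-ALIAS-L» / «ALIAS-L-GEVREY»): THE VOLUME ARITHMETIC OF THE
# ALIASING TAIL — `L_alias ≤ klEngL4Real` as the per-derivative ratio law `ρ·(2/N) ≤ U/(2^26·β)` under the registered volume door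

Cell gate-hubbard-kl, seat p2 g16 (successor item G6 of HOME/HANDOFF «p2 g15»; pen (R77c): «Gevrey tables G1–G5 + the arithmetic lemma
`L_alias ≤ klEngL4Real`», T+, closer-side, no token/row moves).  The (B) door of record
`…FrameShiftDressingSupFlowTablesGN.norm_iteratedFDeriv_klLocSelfEnergyRe_flowFrame_sub_le_aliasing_gevrey_numeral4` (and its last-step twin) carries
aliasing terms `3ʲ·Row_x(Md)·(2/N)^{Md−j−4}·4C₂` with `N = 2(⌊L/4⌋+1)` and Gevrey rows `Row_x(Md) = a_x·(Md!)²·ρ_x^{Md}` (`x` = defect/`J₂`/`J₁`), whose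
four ratios `ρ₁ … ρ₄` are closed expressions in `(m, Ξ, Θ, Φ, Gfr₀|U|)` at the cutoff numerals `X₀ = 8`, `C_χ = 342`, plus far-moment terms `·/(1+L/4)^s`.
This file is the CONSUMER-AGNOSTIC volume arithmetic the (P) closer needs to price them (the choice of `Md`, `s` and the budget split stay the closer's):

* §1 geometry: `two_div_aliasN_le` (`2/N ≤ 4/L`), `aliasN_pow_le`, `div_one_add_quarter_pow_le` (`a/(1+L/4)^s ≤ a·(4/L)^s`);
* §2 the four ratios VERBATIM as they appear in the door of record: `aliasRatio₁_le … aliasRatio₄_le` — each `≤ 2^31·((4+Ξ)+Φ)·16^m` under the door's own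
  hypothesis `Gfr₀|U|Θ·16^{−m} ≤ Λ_m/4`;
* §3 depth and volume: `sixteen_pow_le_of_le_nScales_succ` (`m ≤ n_β+1 ⇒ 16^m ≤ β²/(64π²)`), `four_div_le_of_klEngL4Real_le`
  (`klEngL4Real P R β U ≤ L ⇒ 4/L ≤ U/(2^59·Psq²·Rsq²·β³)`);
* §4 THE ALIAS-L LAW: `aliasRatio_mul_two_div_le` — any `ρ ≤ 2^31·E·16^m` satisfies `ρ·(2/N) ≤ E·U/(2^37·klEngPsq P²·klEngRsq R²·β)` for
  `klBetaMin ≤ β`, `m ≤ nScales β + 1`, `0 < U`, `klEngL4Real P R β U ≤ L`; the Gevrey-row bookkeeping `gevreyRow_mul_pow_le`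
  (`a(Md!)²ρ^{Md}·r^{Md−j−4} ≤ a(Md!)²·B^{j+4}·ε^{Md−j−4}` from `ρ·r ≤ ε`, `ρ ≤ B`) and `aliasRatio_le_sq_beta` (`ρ ≤ 2^22·E·β²`);
* §5 at the CLOSED envelope of `…EngineFlowEnvelopeChoice` (`Ξ := 2^{10}(1+π⁸WU²/2^{11}) + Σ_{j<5}Gfr_j`, `Φ := 1`) under its `U`-door:
  `envelopeE_le` (`(4+Ξ)+1 ≤ 2^{11}·klEngRsq R`) and the headline **`aliasRatio_mul_two_div_le_closed`**: `ρ·(2/N) ≤ U/(2^26·β)` —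
  i.e. every derivative spent on the aliasing tail beyond `j+4` buys a factor `U/(2^26 β)` at ANY volume above the registered door `klEngL₄`
  (`klEngL4Real_le_of_klEngL₄_le`): «L_alias ≤ klEngL4Real» in the only currency-free sense available before the closer fixes `Md` and the budget split.

Pure real arithmetic; no definitions; nothing about the model's sizes is asserted; nothing asserts superconductivity.
References: BGM 2006 §2.3 (2.21)–(2.24) (the cutoff/sector geometry behind `Λ_m = 4^{−m}/32`) [cite: BenfattoGiulianiMastropietro2006].
-/

noncomputable section

namespace Summit.HubbardSuperconductivity.HubbardSuperconductivity.Theorems.EngineV8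

set_option linter.dupNamespace false -- summit = problem name (single-conjunct summit), D-0017

open Real Finset
open Summit.HubbardSuperconductivity.HubbardSuperconductivity.Theorems.KLRegimeSplit
open Summit.HubbardSuperconductivity.HubbardSuperconductivity.Theorems.KLProgrammeLegKernels
open scoped Nat

/-! ## §1 Geometry of the aliasing ratio `2/N`, `N = 2(⌊L/4⌋+1)`, and of the far-moment weight -/

/-- **`2/N ≤ 4/L`** for the door's `N = 2(⌊L/4⌋ + 1)` (`4(⌊L/4⌋+1) > L`). [cite: BenfattoGiulianiMastropietro2006, §2.3 (2.24)] -/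
theorem two_div_aliasN_le {L : ℕ} (hL : 0 < L) : (2 / ((2 * (L / 4 + 1) : ℕ) : ℝ)) ≤ 4 / (L : ℝ) := by
  have hq : L < 4 * (L / 4) + 4 := by
    have h1 := Nat.div_add_mod L 4
    have h2 := Nat.mod_lt L (by norm_num : 0 < 4)
    omega
  have hqR : (L : ℝ) < 4 * ((L / 4 : ℕ) : ℝ) + 4 := by exact_mod_cast hq
  have hN : (((2 * (L / 4 + 1) : ℕ)) : ℝ) = 2 * ((L / 4 : ℕ) : ℝ) + 2 := by push_cast; ring
  have hL' : (0 : ℝ) < L := by exact_mod_cast hL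
  rw [hN, div_le_div_iff₀ (by positivity) hL']
  linarith

/-- Powers of the aliasing ratio: `(2/N)^t ≤ (4/L)^t`. [cite: BenfattoGiulianiMastropietro2006, §2.3 (2.24)] -/
theorem aliasN_pow_le {L : ℕ} (hL : 0 < L) (t : ℕ) :
    (2 / ((2 * (L / 4 + 1) : ℕ) : ℝ)) ^ t ≤ (4 / (L : ℝ)) ^ t :=
  pow_le_pow_left₀ (by positivity) (two_div_aliasN_le hL) t

/-- The far-moment weight of the door: `a/(1 + L/4)^s ≤ a·(4/L)^s` for `0 ≤ a`. [cite: BenfattoGiulianiMastropietro2006, §2.3 (2.24)] -/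
theorem div_one_add_quarter_pow_le {L : ℕ} (hL : 0 < L) {a : ℝ} (ha : 0 ≤ a) (s : ℕ) :
    a / (1 + (L : ℝ) / 4) ^ s ≤ a * (4 / (L : ℝ)) ^ s := by
  have hL' : (0 : ℝ) < L := by exact_mod_cast hL
  have h1 : ((1 + (L : ℝ) / 4) ^ s)⁻¹ ≤ (4 / (L : ℝ)) ^ s := by
    rw [← inv_pow]
    refine pow_le_pow_left₀ (by positivity) ?_ s
    rw [show (4 : ℝ) / L = ((L : ℝ) / 4)⁻¹ by rw [inv_div]]
    exact inv_anti₀ (by positivity) (by linarith)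
  rw [div_eq_mul_inv]
  exact mul_le_mul_of_nonneg_left h1 ha


/-! ## §2 The four Gevrey-table ratios of the door of record (cutoff numerals `X₀ = 8`, `C_χ = 342`) are `≤ 2^31·((4+Ξ)+Φ)·16^m` -/

section Ratios

/-- `Λ_m = (4^m)⁻¹/32`. -/
private theorem klScale_klE0_eq (m : ℕ) : (klScale klE0 m) = ((4 : ℝ) ^ m)⁻¹ / 32 := by
  simp only [klScale, klE0]; ring

/-- `0 < Λ_m`. -/
private theorem klScale_klE0_pos (m : ℕ) : 0 < (klScale klE0 m) := by rw [klScale_klE0_eq]; positivity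

/-- `16^m = 4^m·4^m`. -/
private theorem sixteen_pow_eq (m : ℕ) : (16 : ℝ) ^ m = (4 : ℝ) ^ m * (4 : ℝ) ^ m := by
  rw [← mul_pow]; norm_num

/-- `16·343/Λ_m = 175616·4^m`. -/
private theorem band_tw_eq (m : ℕ) : 16 * (1 + 342) / (klScale klE0 m) = 175616 * (4 : ℝ) ^ m := by
  have hinv : ((klScale klE0 m))⁻¹ = 32 * (4 : ℝ) ^ m := by
    rw [klScale_klE0_eq, inv_div, div_eq_mul_inv, inv_inv]
  rw [div_eq_mul_inv, hinv]; ring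

/-- The band block: `4(4 + 4^mΞ)(1 + 16·343/Λ_m) + 2^{10}Φ4^m ≤ 2^{20}·((4+Ξ)+Φ)·16^m`. -/
private theorem bandBlock_le {Ξ Φ : ℝ} (hΞ0 : 0 ≤ Ξ) (hΦ0 : 0 ≤ Φ) (m : ℕ) :
    (4 * (4 + (4 : ℝ) ^ m * Ξ) * (1 + 16 * (1 + 342) / (klScale klE0 m) * 1) + (2 ^ 10 * Φ * (4 : ℝ) ^ m)) ≤ 2 ^ 20 * ((4 + Ξ) + Φ) * ((4 : ℝ) ^ m * (4 : ℝ) ^ m) := by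
  rw [band_tw_eq]
  have hA1 : 1 ≤ (4 : ℝ) ^ m := one_le_pow₀ (by norm_num)
  have hA0 : 0 ≤ (4 : ℝ) ^ m := by positivity
  have hAA0 : 0 ≤ (4 : ℝ) ^ m * (4 : ℝ) ^ m := by positivity
  have e1 : (4 : ℝ) ^ m ≤ (4 : ℝ) ^ m * (4 : ℝ) ^ m := by nlinarith
  have e2 : (4 : ℝ) ^ m * Ξ ≤ (4 : ℝ) ^ m * (4 : ℝ) ^ m * Ξ := by nlinarith [mul_nonneg hA0 hΞ0]
  have e3 : Φ * (4 : ℝ) ^ m ≤ Φ * ((4 : ℝ) ^ m * (4 : ℝ) ^ m) := by nlinarith [mul_nonneg hΦ0 hA0]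
  nlinarith [mul_nonneg hA0 hΞ0, mul_nonneg hAA0 hΞ0, mul_nonneg hΦ0 hAA0]

/-- The band block is nonnegative. -/
private theorem bandBlock_nonneg {Ξ Φ : ℝ} (hΞ0 : 0 ≤ Ξ) (hΦ0 : 0 ≤ Φ) (m : ℕ) : 0 ≤ (4 * (4 + (4 : ℝ) ^ m * Ξ) * (1 + 16 * (1 + 342) / (klScale klE0 m) * 1) + (2 ^ 10 * Φ * (4 : ℝ) ^ m)) := by
  rw [band_tw_eq]
  have hA0 : 0 ≤ (4 : ℝ) ^ m := by positivity
  have := mul_nonneg hA0 hΞ0; have := mul_nonneg hΦ0 hA0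
  have : 0 ≤ (4 + (4 : ℝ) ^ m * Ξ) * (1 + 175616 * (4 : ℝ) ^ m * 1) := mul_nonneg (by linarith) (by nlinarith)
  nlinarith

/-- The small cross block: `2^{10}Φ4^m ≤ 2^{10}·((4+Ξ)+Φ)·16^m`. -/
private theorem crossBlock_le {Ξ Φ : ℝ} (hΞ0 : 0 ≤ Ξ) (hΦ0 : 0 ≤ Φ) (m : ℕ) : (2 ^ 10 * Φ * (4 : ℝ) ^ m) ≤ 2 ^ 10 * ((4 + Ξ) + Φ) * ((4 : ℝ) ^ m * (4 : ℝ) ^ m) := by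
  have hA1 : 1 ≤ (4 : ℝ) ^ m := one_le_pow₀ (by norm_num)
  have hA0 : 0 ≤ (4 : ℝ) ^ m := by positivity
  have hAA0 : 0 ≤ (4 : ℝ) ^ m * (4 : ℝ) ^ m := by positivity
  have e3 : Φ * (4 : ℝ) ^ m ≤ Φ * ((4 : ℝ) ^ m * (4 : ℝ) ^ m) := by nlinarith [mul_nonneg hΦ0 hA0]
  nlinarith [mul_nonneg hΞ0 hAA0, mul_nonneg hΦ0 hAA0]

/-- The dressing block under the door's `δ ≤ Λ_m/4`: `1 + (6/Λ_m)(Λ_m/128 + 8δ) ≤ 14`, and it is `≥ 0`. -/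
private theorem dressBlock_le {R : RenConsts} (hR0 : 0 ≤ R.Gfr 0) {U Θ : ℝ} (hΘ0 : 0 ≤ Θ) (m : ℕ)
    (hδΛ : (R.Gfr 0 * |U| * Θ * ((16 : ℝ) ^ m)⁻¹) ≤ (klScale klE0 m) / 4) :
    (1 + 6 / (klScale klE0 m) * ((klScale klE0 m) / 128 + 8 * (R.Gfr 0 * |U| * Θ * ((16 : ℝ) ^ m)⁻¹))) ≤ 14 ∧ 0 ≤ (1 + 6 / (klScale klE0 m) * ((klScale klE0 m) / 128 + 8 * (R.Gfr 0 * |U| * Θ * ((16 : ℝ) ^ m)⁻¹))) := by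
  have hΛ0 := klScale_klE0_pos m
  have hΛne : (klScale klE0 m) ≠ 0 := hΛ0.ne'
  have hδ0 : 0 ≤ (R.Gfr 0 * |U| * Θ * ((16 : ℝ) ^ m)⁻¹) := mul_nonneg (mul_nonneg (mul_nonneg hR0 (abs_nonneg U)) hΘ0) (by positivity)
  have hDeq : 6 / (klScale klE0 m) * ((klScale klE0 m) / 128 + 8 * (R.Gfr 0 * |U| * Θ * ((16 : ℝ) ^ m)⁻¹)) = 6 / 128 + 48 * ((R.Gfr 0 * |U| * Θ * ((16 : ℝ) ^ m)⁻¹) / (klScale klE0 m)) := by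
    field_simp
    ring
  have hdq : (R.Gfr 0 * |U| * Θ * ((16 : ℝ) ^ m)⁻¹) / (klScale klE0 m) ≤ 1 / 4 := by rw [div_le_iff₀ hΛ0]; linarith
  have hdq0 : 0 ≤ (R.Gfr 0 * |U| * Θ * ((16 : ℝ) ^ m)⁻¹) / (klScale klE0 m) := div_nonneg hδ0 hΛ0.le
  rw [hDeq]
  constructor <;> linarith

/-- **Ratio 1** (the resummed-band ratio of the defect/`J` rows, VERBATIM as in `…_aliasing_gevrey_numeral4`): `ρ₁(m) ≤ 2^31·((4+Ξ)+Φ)·16^m` under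
`Gfr₀|U|Θ16^{−m} ≤ Λ_m/4`. [cite: BenfattoGiulianiMastropietro2006, §2.3 (2.23)] -/
theorem aliasRatio₁_le {R : RenConsts} (hR0 : 0 ≤ R.Gfr 0) {U Ξ Θ Φ : ℝ} (hΞ0 : 0 ≤ Ξ) (hΘ0 : 0 ≤ Θ) (hΦ0 : 0 ≤ Φ) (m : ℕ)
    (hδΛ : (R.Gfr 0 * |U| * Θ * ((16 : ℝ) ^ m)⁻¹) ≤ (klScale klE0 m) / 4) :
    (2 * (4 * (2 * (4 * (4 + (4 : ℝ) ^ m * Ξ) * (1 + 16 * (1 + 342) / (klScale klE0 m) * 1) + (2 ^ 10 * Φ * (4 : ℝ) ^ m))) * (1 + 6 / (klScale klE0 m) * ((klScale klE0 m) / 128 + 8 * (R.Gfr 0 * |U| * Θ * ((16 : ℝ) ^ m)⁻¹))))) ≤ 2 ^ 31 * ((4 + Ξ) + Φ) * (16 : ℝ) ^ m := by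
  obtain ⟨hD, hD0⟩ := dressBlock_le hR0 hΘ0 m hδΛ
  have hT := bandBlock_le hΞ0 hΦ0 m
  have hE0 : 0 ≤ ((4 + Ξ) + Φ) := by linarith
  have hAA0 : 0 ≤ (4 : ℝ) ^ m * (4 : ℝ) ^ m := by positivity
  have hT'0 : 0 ≤ 2 ^ 20 * ((4 + Ξ) + Φ) * ((4 : ℝ) ^ m * (4 : ℝ) ^ m) := mul_nonneg (mul_nonneg (by norm_num) hE0) hAA0
  calc (2 * (4 * (2 * (4 * (4 + (4 : ℝ) ^ m * Ξ) * (1 + 16 * (1 + 342) / (klScale klE0 m) * 1) + (2 ^ 10 * Φ * (4 : ℝ) ^ m))) * (1 + 6 / (klScale klE0 m) * ((klScale klE0 m) / 128 + 8 * (R.Gfr 0 * |U| * Θ * ((16 : ℝ) ^ m)⁻¹)))))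
      = 16 * ((4 * (4 + (4 : ℝ) ^ m * Ξ) * (1 + 16 * (1 + 342) / (klScale klE0 m) * 1) + (2 ^ 10 * Φ * (4 : ℝ) ^ m)) * (1 + 6 / (klScale klE0 m) * ((klScale klE0 m) / 128 + 8 * (R.Gfr 0 * |U| * Θ * ((16 : ℝ) ^ m)⁻¹)))) := by ring
    _ ≤ 16 * ((2 ^ 20 * ((4 + Ξ) + Φ) * ((4 : ℝ) ^ m * (4 : ℝ) ^ m)) * 14) := mul_le_mul_of_nonneg_left (mul_le_mul hT hD hD0 hT'0) (by norm_num)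
    _ ≤ 2 ^ 31 * ((4 + Ξ) + Φ) * ((4 : ℝ) ^ m * (4 : ℝ) ^ m) := by nlinarith [mul_nonneg hE0 hAA0]
    _ = 2 ^ 31 * ((4 + Ξ) + Φ) * (16 : ℝ) ^ m := by rw [sixteen_pow_eq]

/-- **Ratio 2** (the old-symbol ratio of the defect row): `ρ₂(m) ≤ 2^31·((4+Ξ)+Φ)·16^m` under `Gfr₀|U|Θ16^{−m} ≤ Λ_m/4`.
[cite: BenfattoGiulianiMastropietro2006, §2.3 (2.23)] -/
theorem aliasRatio₂_le {R : RenConsts} (hR0 : 0 ≤ R.Gfr 0) {U Ξ Θ Φ : ℝ} (hΞ0 : 0 ≤ Ξ) (hΘ0 : 0 ≤ Θ) (hΦ0 : 0 ≤ Φ) (m : ℕ)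
    (hδΛ : (R.Gfr 0 * |U| * Θ * ((16 : ℝ) ^ m)⁻¹) ≤ (klScale klE0 m) / 4) :
    (4 * ((4 + (4 : ℝ) ^ m * Ξ) + (2 ^ 10 * Φ * (4 : ℝ) ^ m)) * (1 + 2 * (16 * (1 + 342) / (klScale klE0 m)) * (1 + (R.Gfr 0 * |U| * Θ * ((16 : ℝ) ^ m)⁻¹)))) ≤ 2 ^ 31 * ((4 + Ξ) + Φ) * (16 : ℝ) ^ m := by
  have hΛ0 := klScale_klE0_pos m
  have hA1 : 1 ≤ (4 : ℝ) ^ m := one_le_pow₀ (by norm_num)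
  have hA0 : 0 ≤ (4 : ℝ) ^ m := by positivity
  have hE0 : 0 ≤ ((4 + Ξ) + Φ) := by linarith
  have hδ0 : 0 ≤ (R.Gfr 0 * |U| * Θ * ((16 : ℝ) ^ m)⁻¹) := mul_nonneg (mul_nonneg (mul_nonneg hR0 (abs_nonneg U)) hΘ0) (by positivity)
  have hδ1 : (R.Gfr 0 * |U| * Θ * ((16 : ℝ) ^ m)⁻¹) ≤ 1 / 128 := by
    have h1 : (klScale klE0 m) / 4 ≤ 1 / 128 := by
      rw [klScale_klE0_eq]
      have : ((4 : ℝ) ^ m)⁻¹ ≤ 1 := inv_le_one_of_one_le₀ hA1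
      linarith
    exact hδΛ.trans h1
  have hS1 : (4 + (4 : ℝ) ^ m * Ξ) + (2 ^ 10 * Φ * (4 : ℝ) ^ m) ≤ 2 ^ 10 * ((4 + Ξ) + Φ) * (4 : ℝ) ^ m := by
    nlinarith [mul_nonneg hA0 hΞ0, mul_nonneg hΦ0 hA0]
  have hAδ : (4 : ℝ) ^ m * (R.Gfr 0 * |U| * Θ * ((16 : ℝ) ^ m)⁻¹) ≤ (4 : ℝ) ^ m * (1 / 128) := mul_le_mul_of_nonneg_left hδ1 hA0
  have hS2 : 1 + 2 * (16 * (1 + 342) / (klScale klE0 m)) * (1 + (R.Gfr 0 * |U| * Θ * ((16 : ℝ) ^ m)⁻¹)) ≤ 2 ^ 19 * (4 : ℝ) ^ m := by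
    rw [band_tw_eq]; nlinarith [mul_nonneg hA0 hδ0]
  have hS2_0 : 0 ≤ 1 + 2 * (16 * (1 + 342) / (klScale klE0 m)) * (1 + (R.Gfr 0 * |U| * Θ * ((16 : ℝ) ^ m)⁻¹)) := by
    rw [band_tw_eq]; nlinarith [mul_nonneg hA0 hδ0]
  have hR0' : 0 ≤ 2 ^ 10 * ((4 + Ξ) + Φ) * (4 : ℝ) ^ m := mul_nonneg (mul_nonneg (by norm_num) hE0) hA0
  calc (4 * ((4 + (4 : ℝ) ^ m * Ξ) + (2 ^ 10 * Φ * (4 : ℝ) ^ m)) * (1 + 2 * (16 * (1 + 342) / (klScale klE0 m)) * (1 + (R.Gfr 0 * |U| * Θ * ((16 : ℝ) ^ m)⁻¹))))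
      = 4 * (((4 + (4 : ℝ) ^ m * Ξ) + (2 ^ 10 * Φ * (4 : ℝ) ^ m)) * (1 + 2 * (16 * (1 + 342) / (klScale klE0 m)) * (1 + (R.Gfr 0 * |U| * Θ * ((16 : ℝ) ^ m)⁻¹)))) := by ring
    _ ≤ 4 * ((2 ^ 10 * ((4 + Ξ) + Φ) * (4 : ℝ) ^ m) * (2 ^ 19 * (4 : ℝ) ^ m)) := mul_le_mul_of_nonneg_left (mul_le_mul hS1 hS2 hS2_0 hR0') (by norm_num)
    _ = 2 ^ 31 * ((4 + Ξ) + Φ) * ((4 : ℝ) ^ m * (4 : ℝ) ^ m) := by ring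
    _ = 2 ^ 31 * ((4 + Ξ) + Φ) * (16 : ℝ) ^ m := by rw [sixteen_pow_eq]

/-- **Ratio 3** (the `J₂` ratio / second `J₁` ratio, `2ρ₆`): `ρ₃(m) ≤ 2^31·((4+Ξ)+Φ)·16^m` under `Gfr₀|U|Θ16^{−m} ≤ Λ_m/4`.
[cite: BenfattoGiulianiMastropietro2006, §2.3 (2.23)] -/
theorem aliasRatio₃_le {R : RenConsts} (hR0 : 0 ≤ R.Gfr 0) {U Ξ Θ Φ : ℝ} (hΞ0 : 0 ≤ Ξ) (hΘ0 : 0 ≤ Θ) (hΦ0 : 0 ≤ Φ) (m : ℕ)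
    (hδΛ : (R.Gfr 0 * |U| * Θ * ((16 : ℝ) ^ m)⁻¹) ≤ (klScale klE0 m) / 4) :
    (2 * (2 * (2 ^ 10 * Φ * (4 : ℝ) ^ m) + 2 * (4 * (2 * (4 * (4 + (4 : ℝ) ^ m * Ξ) * (1 + 16 * (1 + 342) / (klScale klE0 m) * 1) + (2 ^ 10 * Φ * (4 : ℝ) ^ m))) * (1 + 6 / (klScale klE0 m) * ((klScale klE0 m) / 128 + 8 * (R.Gfr 0 * |U| * Θ * ((16 : ℝ) ^ m)⁻¹)))))) ≤ 2 ^ 31 * ((4 + Ξ) + Φ) * (16 : ℝ) ^ m := by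
  obtain ⟨hD, hD0⟩ := dressBlock_le hR0 hΘ0 m hδΛ
  have hT := bandBlock_le hΞ0 hΦ0 m
  have hF := crossBlock_le hΞ0 hΦ0 m
  have hE0 : 0 ≤ ((4 + Ξ) + Φ) := by linarith
  have hAA0 : 0 ≤ (4 : ℝ) ^ m * (4 : ℝ) ^ m := by positivity
  have hT'0 : 0 ≤ 2 ^ 20 * ((4 + Ξ) + Φ) * ((4 : ℝ) ^ m * (4 : ℝ) ^ m) := mul_nonneg (mul_nonneg (by norm_num) hE0) hAA0
  have hTD : (4 * (4 + (4 : ℝ) ^ m * Ξ) * (1 + 16 * (1 + 342) / (klScale klE0 m) * 1) + (2 ^ 10 * Φ * (4 : ℝ) ^ m)) * (1 + 6 / (klScale klE0 m) * ((klScale klE0 m) / 128 + 8 * (R.Gfr 0 * |U| * Θ * ((16 : ℝ) ^ m)⁻¹))) ≤ (2 ^ 20 * ((4 + Ξ) + Φ) * ((4 : ℝ) ^ m * (4 : ℝ) ^ m)) * 14 := mul_le_mul hT hD hD0 hT'0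
  calc (2 * (2 * (2 ^ 10 * Φ * (4 : ℝ) ^ m) + 2 * (4 * (2 * (4 * (4 + (4 : ℝ) ^ m * Ξ) * (1 + 16 * (1 + 342) / (klScale klE0 m) * 1) + (2 ^ 10 * Φ * (4 : ℝ) ^ m))) * (1 + 6 / (klScale klE0 m) * ((klScale klE0 m) / 128 + 8 * (R.Gfr 0 * |U| * Θ * ((16 : ℝ) ^ m)⁻¹))))))
      = 4 * (2 ^ 10 * Φ * (4 : ℝ) ^ m) + 32 * ((4 * (4 + (4 : ℝ) ^ m * Ξ) * (1 + 16 * (1 + 342) / (klScale klE0 m) * 1) + (2 ^ 10 * Φ * (4 : ℝ) ^ m)) * (1 + 6 / (klScale klE0 m) * ((klScale klE0 m) / 128 + 8 * (R.Gfr 0 * |U| * Θ * ((16 : ℝ) ^ m)⁻¹)))) := by ring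
    _ ≤ 4 * (2 ^ 10 * ((4 + Ξ) + Φ) * ((4 : ℝ) ^ m * (4 : ℝ) ^ m)) + 32 * ((2 ^ 20 * ((4 + Ξ) + Φ) * ((4 : ℝ) ^ m * (4 : ℝ) ^ m)) * 14) := by linarith
    _ ≤ 2 ^ 31 * ((4 + Ξ) + Φ) * ((4 : ℝ) ^ m * (4 : ℝ) ^ m) := by nlinarith [mul_nonneg hE0 hAA0]
    _ = 2 ^ 31 * ((4 + Ξ) + Φ) * (16 : ℝ) ^ m := by rw [sixteen_pow_eq]

/-- **Ratio 4** (the first `J₁` ratio, `4ρ₆`): `ρ₄(m) ≤ 2^31·((4+Ξ)+Φ)·16^m` under `Gfr₀|U|Θ16^{−m} ≤ Λ_m/4`.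
[cite: BenfattoGiulianiMastropietro2006, §2.3 (2.23)] -/
theorem aliasRatio₄_le {R : RenConsts} (hR0 : 0 ≤ R.Gfr 0) {U Ξ Θ Φ : ℝ} (hΞ0 : 0 ≤ Ξ) (hΘ0 : 0 ≤ Θ) (hΦ0 : 0 ≤ Φ) (m : ℕ)
    (hδΛ : (R.Gfr 0 * |U| * Θ * ((16 : ℝ) ^ m)⁻¹) ≤ (klScale klE0 m) / 4) :
    (2 * (2 * (2 * (2 ^ 10 * Φ * (4 : ℝ) ^ m) + 2 * (4 * (2 * (4 * (4 + (4 : ℝ) ^ m * Ξ) * (1 + 16 * (1 + 342) / (klScale klE0 m) * 1) + (2 ^ 10 * Φ * (4 : ℝ) ^ m))) * (1 + 6 / (klScale klE0 m) * ((klScale klE0 m) / 128 + 8 * (R.Gfr 0 * |U| * Θ * ((16 : ℝ) ^ m)⁻¹))))))) ≤ 2 ^ 31 * ((4 + Ξ) + Φ) * (16 : ℝ) ^ m := by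
  obtain ⟨hD, hD0⟩ := dressBlock_le hR0 hΘ0 m hδΛ
  have hT := bandBlock_le hΞ0 hΦ0 m
  have hF := crossBlock_le hΞ0 hΦ0 m
  have hE0 : 0 ≤ ((4 + Ξ) + Φ) := by linarith
  have hAA0 : 0 ≤ (4 : ℝ) ^ m * (4 : ℝ) ^ m := by positivity
  have hT'0 : 0 ≤ 2 ^ 20 * ((4 + Ξ) + Φ) * ((4 : ℝ) ^ m * (4 : ℝ) ^ m) := mul_nonneg (mul_nonneg (by norm_num) hE0) hAA0
  have hTD : (4 * (4 + (4 : ℝ) ^ m * Ξ) * (1 + 16 * (1 + 342) / (klScale klE0 m) * 1) + (2 ^ 10 * Φ * (4 : ℝ) ^ m)) * (1 + 6 / (klScale klE0 m) * ((klScale klE0 m) / 128 + 8 * (R.Gfr 0 * |U| * Θ * ((16 : ℝ) ^ m)⁻¹))) ≤ (2 ^ 20 * ((4 + Ξ) + Φ) * ((4 : ℝ) ^ m * (4 : ℝ) ^ m)) * 14 := mul_le_mul hT hD hD0 hT'0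
  calc (2 * (2 * (2 * (2 ^ 10 * Φ * (4 : ℝ) ^ m) + 2 * (4 * (2 * (4 * (4 + (4 : ℝ) ^ m * Ξ) * (1 + 16 * (1 + 342) / (klScale klE0 m) * 1) + (2 ^ 10 * Φ * (4 : ℝ) ^ m))) * (1 + 6 / (klScale klE0 m) * ((klScale klE0 m) / 128 + 8 * (R.Gfr 0 * |U| * Θ * ((16 : ℝ) ^ m)⁻¹)))))))
      = 8 * (2 ^ 10 * Φ * (4 : ℝ) ^ m) + 64 * ((4 * (4 + (4 : ℝ) ^ m * Ξ) * (1 + 16 * (1 + 342) / (klScale klE0 m) * 1) + (2 ^ 10 * Φ * (4 : ℝ) ^ m)) * (1 + 6 / (klScale klE0 m) * ((klScale klE0 m) / 128 + 8 * (R.Gfr 0 * |U| * Θ * ((16 : ℝ) ^ m)⁻¹)))) := by ring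
    _ ≤ 8 * (2 ^ 10 * ((4 + Ξ) + Φ) * ((4 : ℝ) ^ m * (4 : ℝ) ^ m)) + 64 * ((2 ^ 20 * ((4 + Ξ) + Φ) * ((4 : ℝ) ^ m * (4 : ℝ) ^ m)) * 14) := by linarith
    _ ≤ 2 ^ 31 * ((4 + Ξ) + Φ) * ((4 : ℝ) ^ m * (4 : ℝ) ^ m) := by nlinarith [mul_nonneg hE0 hAA0]
    _ = 2 ^ 31 * ((4 + Ξ) + Φ) * (16 : ℝ) ^ m := by rw [sixteen_pow_eq]

end Ratios

/-! ## §3 Depth and volume -/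

/-- **Depth**: `m ≤ n_β + 1 ⇒ 16^m ≤ β²/(64π²)` (`16^{n_β} ≤ β²/(1024π²)`, `…SplitFrameDegreeGuard`). [cite: BenfattoGiulianiMastropietro2006, §2.3 (2.21)] -/
theorem sixteen_pow_le_of_le_nScales_succ {β : ℝ} (hβ : klBetaMin ≤ β) {m : ℕ} (hm : m ≤ nScales β + 1) :
    (16 : ℝ) ^ m ≤ β ^ 2 / (64 * π ^ 2) := by
  have h := sixteen_pow_nScales_le hβ
  calc (16 : ℝ) ^ m ≤ 16 ^ (nScales β + 1) := pow_le_pow_right₀ (by norm_num) hm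
    _ = 16 * 16 ^ nScales β := by rw [pow_succ]; ring
    _ ≤ 16 * (β ^ 2 / (1024 * π ^ 2)) := by gcongr
    _ = β ^ 2 / (64 * π ^ 2) := by ring

/-- **Volume**: `klEngL4Real P R β U ≤ L ⇒ 4/L ≤ U/(2^59·klEngPsq P²·klEngRsq R²·β³)` (`klEngL4Real = 2^61·Psq²·Rsq²·β³/U`).
[cite: BenfattoGiulianiMastropietro2006, §2.3 (2.24)] -/
theorem four_div_le_of_klEngL4Real_le {P : SplitConsts} {R : RenConsts} {β U : ℝ} (hU : 0 < U) (hβ : 0 < β) {L : ℕ}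
    (hL : klEngL4Real P R β U ≤ L) :
    (4 : ℝ) / L ≤ U / (2 ^ 59 * klEngPsq P ^ 2 * klEngRsq R ^ 2 * β ^ 3) := by
  have hP := klEngPsq_pos P
  have hRq := klEngRsq_pos R
  have hPR : 0 < klEngPsq P ^ 2 * klEngRsq R ^ 2 := mul_pos (pow_pos hP 2) (pow_pos hRq 2)
  have hden : 0 < 2 ^ 59 * klEngPsq P ^ 2 * klEngRsq R ^ 2 * β ^ 3 := by
    have := mul_pos (mul_pos hPR (pow_pos hβ 3)) (by norm_num : (0 : ℝ) < 2 ^ 59); linarith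
  have hL4 : 0 < klEngL4Real P R β U := by
    unfold klEngL4Real
    exact div_pos (by have := mul_pos (mul_pos hPR (pow_pos hβ 3)) (by norm_num : (0 : ℝ) < 2 ^ 61); linarith) hU
  have hLpos : (0 : ℝ) < L := lt_of_lt_of_le hL4 hL
  unfold klEngL4Real at hL
  rw [div_le_iff₀ hU] at hL
  rw [div_le_div_iff₀ hLpos hden]
  linarith

/-! ## §4 The ALIAS-L law -/

/-- **THE ALIAS-L LAW (generic envelope)**: any ratio `ρ ≤ 2^31·E·16^m` (`0 ≤ E`) satisfies `ρ·(2/N) ≤ E·U/(2^37·klEngPsq P²·klEngRsq R²·β)` at every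
volume `L ≥ klEngL4Real P R β U`, every depth `m ≤ n_β + 1`, `klBetaMin ≤ β`, `0 < U` (`π² ≥ 8` spent). [cite: BenfattoGiulianiMastropietro2006, §2.3 (2.24)] -/
theorem aliasRatio_mul_two_div_le {P : SplitConsts} {R : RenConsts} {β U : ℝ} (hβ : klBetaMin ≤ β) (hU : 0 < U) {L : ℕ}
    (hL : klEngL4Real P R β U ≤ L) {m : ℕ} (hm : m ≤ nScales β + 1) {E ρ : ℝ} (hE : 0 ≤ E) (hρ : ρ ≤ 2 ^ 31 * E * (16 : ℝ) ^ m) :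
    ρ * (2 / ((2 * (L / 4 + 1) : ℕ) : ℝ)) ≤ E * U / (2 ^ 37 * klEngPsq P ^ 2 * klEngRsq R ^ 2 * β) := by
  have h128 : (128 : ℝ) ≤ β := by simpa [klBetaMin] using hβ
  have hβ0 : (0 : ℝ) < β := by linarith
  have hP := klEngPsq_pos P
  have hRq := klEngRsq_pos R
  have hPR : 0 < klEngPsq P ^ 2 * klEngRsq R ^ 2 := mul_pos (pow_pos hP 2) (pow_pos hRq 2)
  have hPne : klEngPsq P ≠ 0 := hP.ne'
  have hRne : klEngRsq R ≠ 0 := hRq.ne'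
  have hβne : β ≠ 0 := hβ0.ne'
  have hπne : (π : ℝ) ≠ 0 := Real.pi_pos.ne'
  have hL4 : 0 < klEngL4Real P R β U := by
    unfold klEngL4Real
    exact div_pos (by have := mul_pos (mul_pos hPR (pow_pos hβ0 3)) (by norm_num : (0 : ℝ) < 2 ^ 61); linarith) hU
  have hLpos : (0 : ℝ) < L := lt_of_lt_of_le hL4 hL
  have hLnat : 0 < L := by exact_mod_cast hLpos
  have h16 := sixteen_pow_le_of_le_nScales_succ hβ hm
  have h4L := four_div_le_of_klEngL4Real_le (P := P) (R := R) hU hβ0 hL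
  have hB0 : 0 ≤ 2 ^ 31 * E * (16 : ℝ) ^ m := mul_nonneg (mul_nonneg (by norm_num) hE) (by positivity)
  have hπ : (8 : ℝ) ≤ π ^ 2 := by nlinarith [Real.pi_gt_three]
  have hden1 : 0 < 2 ^ 37 * (klEngPsq P ^ 2 * klEngRsq R ^ 2) * β := by
    have := mul_pos (mul_pos hPR hβ0) (by norm_num : (0 : ℝ) < 2 ^ 37); linarith
  calc ρ * (2 / ((2 * (L / 4 + 1) : ℕ) : ℝ))
      ≤ (2 ^ 31 * E * (16 : ℝ) ^ m) * (4 / (L : ℝ)) := mul_le_mul hρ (two_div_aliasN_le hLnat) (by positivity) hB0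
    _ ≤ (2 ^ 31 * E * (β ^ 2 / (64 * π ^ 2))) * (U / (2 ^ 59 * klEngPsq P ^ 2 * klEngRsq R ^ 2 * β ^ 3)) :=
        mul_le_mul (mul_le_mul_of_nonneg_left h16 (mul_nonneg (by norm_num) hE)) h4L (by positivity)
          (mul_nonneg (mul_nonneg (by norm_num) hE) (by positivity))
    _ = E * U / (2 ^ 34 * π ^ 2 * (klEngPsq P ^ 2 * klEngRsq R ^ 2) * β) := by
        field_simp
        ring
    _ ≤ E * U / (2 ^ 37 * (klEngPsq P ^ 2 * klEngRsq R ^ 2) * β) := by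
        refine div_le_div_of_nonneg_left (mul_nonneg hE hU.le) hden1 ?_
        nlinarith [mul_pos hPR hβ0]
    _ = E * U / (2 ^ 37 * klEngPsq P ^ 2 * klEngRsq R ^ 2 * β) := by ring

/-- A ratio `≤ 2^31·E·16^m` is `≤ 2^22·E·β²` at depth `m ≤ n_β + 1` (`64π² ≥ 2^9`). [cite: BenfattoGiulianiMastropietro2006, §2.3 (2.21)] -/
theorem aliasRatio_le_sq_beta {β : ℝ} (hβ : klBetaMin ≤ β) {m : ℕ} (hm : m ≤ nScales β + 1) {E ρ : ℝ} (hE : 0 ≤ E)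
    (hρ : ρ ≤ 2 ^ 31 * E * (16 : ℝ) ^ m) : ρ ≤ 2 ^ 22 * E * β ^ 2 := by
  have h16 := sixteen_pow_le_of_le_nScales_succ hβ hm
  have hπ : (8 : ℝ) ≤ π ^ 2 := by nlinarith [Real.pi_gt_three]
  have hπ0 : (0 : ℝ) < π ^ 2 := by positivity
  have h1 : β ^ 2 / (64 * π ^ 2) ≤ β ^ 2 / 2 ^ 9 :=
    div_le_div_of_nonneg_left (sq_nonneg β) (by norm_num) (by nlinarith)
  calc ρ ≤ 2 ^ 31 * E * (16 : ℝ) ^ m := hρ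
    _ ≤ 2 ^ 31 * E * (β ^ 2 / 2 ^ 9) := mul_le_mul_of_nonneg_left (h16.trans h1) (mul_nonneg (by norm_num) hE)
    _ = 2 ^ 22 * E * β ^ 2 := by ring

/-- **Gevrey-row bookkeeping**: `a·(Md!)²·ρ^{Md}·r^{Md−j−4} ≤ a·(Md!)²·B^{j+4}·ε^{Md−j−4}` from `ρ·r ≤ ε`, `ρ ≤ B` (`j+4 ≤ Md`; all quantities `≥ 0`) — how a
per-derivative ratio law prices the door's `Row_x(Md)·(2/N)^{Md−j−4}`. [cite: BenfattoGiulianiMastropietro2006, §2.3 (2.24)] -/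
theorem gevreyRow_mul_pow_le {a ρ r ε B : ℝ} (ha : 0 ≤ a) (hρ0 : 0 ≤ ρ) (hr0 : 0 ≤ r) (hρr : ρ * r ≤ ε) (hρB : ρ ≤ B)
    {Md j : ℕ} (hM : j + 4 ≤ Md) :
    a * ((Md ! : ℝ)) ^ 2 * ρ ^ Md * r ^ (Md - j - 4) ≤ a * ((Md ! : ℝ)) ^ 2 * B ^ (j + 4) * ε ^ (Md - j - 4) := by
  obtain ⟨t, rfl⟩ : ∃ t, Md = j + 4 + t := ⟨Md - (j + 4), by omega⟩
  have ht : j + 4 + t - j - 4 = t := by omega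
  rw [ht, pow_add]
  have h1 : ρ ^ (j + 4) ≤ B ^ (j + 4) := pow_le_pow_left₀ hρ0 hρB _
  have h2 : ρ ^ t * r ^ t ≤ ε ^ t := by rw [← mul_pow]; exact pow_le_pow_left₀ (mul_nonneg hρ0 hr0) hρr t
  have ha2 : 0 ≤ a * (((j + 4 + t) ! : ℝ)) ^ 2 := mul_nonneg ha (by positivity)
  calc a * (((j + 4 + t) ! : ℝ)) ^ 2 * (ρ ^ (j + 4) * ρ ^ t) * r ^ t
      = a * (((j + 4 + t) ! : ℝ)) ^ 2 * (ρ ^ (j + 4) * (ρ ^ t * r ^ t)) := by ring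
    _ ≤ a * (((j + 4 + t) ! : ℝ)) ^ 2 * (B ^ (j + 4) * ε ^ t) :=
        mul_le_mul_of_nonneg_left (mul_le_mul h1 h2 (mul_nonneg (pow_nonneg hρ0 _) (pow_nonneg hr0 _)) ((pow_nonneg hρ0 _).trans h1)) ha2
    _ = a * (((j + 4 + t) ! : ℝ)) ^ 2 * B ^ (j + 4) * ε ^ t := by ring

/-! ## §5 At the closed envelope of `…EngineFlowEnvelopeChoice` -/

/-- **The envelope size at the closed choice**: with `Ξ := 2^{10}(1 + π⁸WU²/2^{11}) + Σ_{j<5} Gfr_j`, `Φ := 1` and under the `U`-door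
`Gfr₀|U| + (Σ_{j<5}Gfr_j + π⁸W/2^{11})U² ≤ 1/128`: `(4 + Ξ) + 1 ≤ 2^{11}·klEngRsq R` (`Gfr_j ≤ klEngRsq R`, `klEngRsq R ≥ 1`).
[cite: BenfattoGiulianiMastropietro2006, §3 (3.2)] -/
theorem envelopeE_le {R : RenConsts} (hR : ∀ j, 0 ≤ R.Gfr j) {W U : ℝ}
    (hdoor : R.Gfr 0 * |U| + ((∑ j ∈ range 5, R.Gfr j) + Real.pi ^ 8 * W / 2 ^ 11) * U ^ 2 ≤ 1 / 128) :
    (4 + (2 ^ 10 * (1 + Real.pi ^ 8 * (W * U ^ 2) / 2 ^ 11) + ∑ j ∈ range 5, R.Gfr j)) + 1 ≤ 2 ^ 11 * klEngRsq R := by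
  have hS : ∑ j ∈ range 5, R.Gfr j ≤ ∑ _j ∈ range 5, klEngRsq R := sum_le_sum fun j hj => gfr_le_klEngRsq R (mem_range.1 hj)
  rw [sum_const, card_range, nsmul_eq_mul] at hS
  have hS0 : 0 ≤ ∑ j ∈ range 5, R.Gfr j := sum_nonneg fun j _ => hR j
  have hR1 := one_le_klEngRsq R
  have h0 : 0 ≤ R.Gfr 0 * |U| := mul_nonneg (hR 0) (abs_nonneg U)
  have hSU : 0 ≤ (∑ j ∈ range 5, R.Gfr j) * U ^ 2 := mul_nonneg hS0 (sq_nonneg U)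
  have hx : Real.pi ^ 8 * (W * U ^ 2) / 2 ^ 11 ≤ 1 / 128 := by
    have he : Real.pi ^ 8 * (W * U ^ 2) / 2 ^ 11 = Real.pi ^ 8 * W / 2 ^ 11 * U ^ 2 := by ring
    rw [he]; nlinarith
  push_cast at hS
  nlinarith

/-- **THE ALIAS-L LAW AT THE CLOSED ENVELOPE (headline)**: with `(Ξ, Φ)` of `…EngineFlowEnvelopeChoice` under its `U`-door, any ratio
`ρ ≤ 2^31·((4+Ξ)+1)·16^m` satisfies **`ρ·(2/N) ≤ U/(2^26·β)`** at every volume `L ≥ klEngL4Real P R β U` (a fortiori `klEngL₄ P R β U ≤ L`), every depth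
`m ≤ n_β + 1`, `klBetaMin ≤ β`, `0 < U`: every derivative spent on the aliasing tail beyond `j + 4` buys `U/(2^26 β)` — «L_alias ≤ klEngL4Real».
[cite: BenfattoGiulianiMastropietro2006, §2.3 (2.24)] -/
theorem aliasRatio_mul_two_div_le_closed {P : SplitConsts} {R : RenConsts} (hR : ∀ j, 0 ≤ R.Gfr j) {W : ℝ} (hW : 0 ≤ W) {β U : ℝ}
    (hβ : klBetaMin ≤ β) (hU : 0 < U) (hdoor : R.Gfr 0 * |U| + ((∑ j ∈ range 5, R.Gfr j) + Real.pi ^ 8 * W / 2 ^ 11) * U ^ 2 ≤ 1 / 128)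
    {L : ℕ} (hL : klEngL4Real P R β U ≤ L) {m : ℕ} (hm : m ≤ nScales β + 1) {ρ : ℝ}
    (hρ : ρ ≤ 2 ^ 31 * ((4 + (2 ^ 10 * (1 + Real.pi ^ 8 * (W * U ^ 2) / 2 ^ 11) + ∑ j ∈ range 5, R.Gfr j)) + 1) * (16 : ℝ) ^ m) :
    ρ * (2 / ((2 * (L / 4 + 1) : ℕ) : ℝ)) ≤ U / (2 ^ 26 * β) := by
  have hE0 : 0 ≤ (4 + (2 ^ 10 * (1 + Real.pi ^ 8 * (W * U ^ 2) / 2 ^ 11) + ∑ j ∈ range 5, R.Gfr j)) + 1 := by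
    have := Xi_nonneg hR hW U; linarith
  have h := aliasRatio_mul_two_div_le (P := P) (R := R) hβ hU hL hm hE0 hρ
  have hE := envelopeE_le hR hdoor
  have h128 : (128 : ℝ) ≤ β := by simpa [klBetaMin] using hβ
  have hβ0 : (0 : ℝ) < β := by linarith
  have hP1 := one_le_klEngPsq P
  have hR1 := one_le_klEngRsq R
  have hP2 : 1 ≤ klEngPsq P ^ 2 := one_le_pow₀ hP1
  have hPR : 0 < klEngPsq P ^ 2 * klEngRsq R ^ 2 := mul_pos (pow_pos (klEngPsq_pos P) 2) (pow_pos (klEngRsq_pos R) 2)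
  have hden1 : 0 < 2 ^ 37 * klEngPsq P ^ 2 * klEngRsq R ^ 2 * β := by
    have := mul_pos (mul_pos hPR hβ0) (by norm_num : (0 : ℝ) < 2 ^ 37); linarith
  have hden2 : 0 < 2 ^ 26 * β := by linarith
  refine h.trans ?_
  rw [div_le_div_iff₀ hden1 hden2]
  -- `E·U·(2^26 β) ≤ U·(2^37 Psq² Rsq² β)` from `E ≤ 2^11 Rsq ≤ 2^11 Psq² Rsq²`
  have hE' : (4 + (2 ^ 10 * (1 + Real.pi ^ 8 * (W * U ^ 2) / 2 ^ 11) + ∑ j ∈ range 5, R.Gfr j)) + 1 ≤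
      2 ^ 11 * (klEngPsq P ^ 2 * klEngRsq R ^ 2) := by
    have h1 : klEngRsq R ≤ klEngPsq P ^ 2 * klEngRsq R ^ 2 := by nlinarith
    nlinarith
  have hUβ : 0 ≤ U * β := mul_nonneg hU.le hβ0.le
  nlinarith [mul_le_mul_of_nonneg_right hE' hUβ]

end Summit.HubbardSuperconductivity.HubbardSuperconductivity.Theorems.EngineV8

end
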